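import Mathlib
import HarnessLib
import Summits.Ventures.LatticeQCDFlow.Exactness.NCMCGeneralSpaceBennettRootVariance
import Summits.Ventures.LatticeQCDFlow.Exactness.NCMCGeneralSpaceDissipation

/-!
# Bounds on the variance constant `1/G − 2` of the self-consistent Bennett estimate: the switch acceptance brackets it, both one-sided Jarzynski variances dominate it

HONEST FRAMING: exact (Metropolis-corrected) sampling algorithms for lattice gauge theory;
figures of merit are autocorrelation/cost numbers at stated couplings and volumes; no
continuum-physics claim.

Venture `LatticeQCDFlow` (cell pub-lqcd), topic `Exactness`; FANOUT row 13 (`eng-snf`, GEN-15).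
NEW WORK of the cell (bookkeeping on top of GEN-11's `bennett_lower_bound` and
`NCMCGeneralSpaceBennettRoot`), not a published result; nothing is cited as a fact (Bennett 1976,
Shirts–Bair–Hooker–Pande 2003 named only).  Companion of `NCMCGeneralSpaceBennettRootVariance.lean`
(`s²/κ² = 1/G − 2`) and `…BennettRootCLT.lean` (`√n (ΔF̂_BAR,n − ΔF) →d N(0, 1/G − 2)`): what the
constant `1/G − 2` can be compared with among the numbers the engine already reports.

## Content (a Crooks pair with `e^{−ΔF} = Z₁/Z₀`; `G = E_{P_F} σ(ΔF − W)` the overlap;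
`acc = E_{P_F} min(1, e^{−(W−ΔF)})` the Metropolized switch acceptance at `c = ΔF`;
`ESS_F = (E_F e^{−W})²/E_F e^{−2W}`, `ESS_R = (E_R e^{W})²/E_R e^{2W}` the two Kish fractions)

* **`CrooksPair.inv_overlap_sub_two_le_of_accept`** / **`CrooksPair.inv_accept_sub_two_le`** —
  `1/acc − 2 ≤ 1/G − 2 ≤ 2/acc − 2` (`acc/2 ≤ G ≤ acc`, GEN-11): the BAR variance constant is within
  a factor of the rejection odds of the exact switch — a protocol with switch acceptance `acc` needs
  at most `2(1 − acc)/(acc ε²)` independent pairs for a BAR standard error `ε`.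
* **`CrooksPair.inv_overlap_sub_two_le_inv_essF_sub_one`** — `1/G − 2 ≤ 1/ESS_F − 1`
  (`bennett_lower_bound` with the constant statistic `α ≡ 1`, whose two-sample estimator is the
  forward exponential average): solving Bennett's equation on `n` pairs is, to leading order, never
  worse than the Jarzynski average of the same `n` forward works (GEN-12
  `tendstoInDistribution_jarzynskiEstimate`: variance `(1/ESS_F − 1)/n`) — the reverse leg never
  hurts; requires `e^{−W} ∈ L²(P_F)` (else `ESS_F = 0` and the right side is not a variance).
* **`CrooksPair.inv_overlap_sub_two_le_inv_essR_sub_one`** — `1/G − 2 ≤ 1/ESS_R − 1` (the pair read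
  backwards, `CrooksPair.symm`; `e^{W} ∈ L²(P_R)`).

Scope / NOT CLAIMED: population constants only; equal numbers of forward and reverse evolutions; cost
accounting (a pair costs two evolutions) is left to the reader: at equal COST the comparison is
`(1/G − 2)/n` against `(1/ESS_F − 1)/(2n)`, which this file does not order.
-/

namespace Summit.Ventures.LatticeQCDFlow.Exactness.GeneralNCMC

open MeasureTheory ProbabilityTheory Set Filter
open scoped ENNReal

variable {Ω E : Type*} [MeasurableSpace Ω] [MeasurableSpace E]

namespace CrooksPair

variable {ν₀ ν₁ : Measure Ω} {κF κR : Kernel Ω E} {s e : E → Ω} {W : E → ℝ}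

/-! ## The switch acceptance brackets the BAR variance constant -/

/-- **`1/G − 2 ≤ 2/acc − 2`** (stated at every `c`; at `c = ΔF` the two integrals are the overlap `G`
and the switch acceptance `acc`): since `acc/2 ≤ G` (`half_accept_le_integral_sigmoid`), the BAR
variance constant is at most twice the rejection odds `(1 − acc)/acc` of the exact switch. -/
theorem inv_overlap_sub_two_le_of_accept [IsFiniteMeasure ν₀] [IsMarkovKernel κF]
    (h0 : ν₀ univ ≠ 0) (h : CrooksPair ν₀ ν₁ κF κR s e W) (c : ℝ) :
    1 / (∫ ε, Real.sigmoid (c - W ε) ∂(fwdPathLaw ν₀ κF)) - 2 ≤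
      2 / (∫ ε, min 1 (Real.exp (-(W ε - c))) ∂(fwdPathLaw ν₀ κF)) - 2 := by
  have hG := h.overlap_pos h0 c
  have hhalf := h.half_accept_le_integral_sigmoid h0 c
  have hacc : 0 < ∫ ε, min 1 (Real.exp (-(W ε - c))) ∂(fwdPathLaw ν₀ κF) := by
    have := h.integral_sigmoid_le_accept h0 c
    linarith
  rw [sub_le_sub_iff_right, div_le_div_iff₀ hG hacc]
  linarith

/-- **`1/acc − 2 ≤ 1/G − 2`** (every `c`): since `G ≤ acc` (`integral_sigmoid_le_accept`). -/
theorem inv_accept_sub_two_le [IsFiniteMeasure ν₀] [IsMarkovKernel κF] (h0 : ν₀ univ ≠ 0)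
    (h : CrooksPair ν₀ ν₁ κF κR s e W) (c : ℝ) :
    1 / (∫ ε, min 1 (Real.exp (-(W ε - c))) ∂(fwdPathLaw ν₀ κF)) - 2 ≤
      1 / (∫ ε, Real.sigmoid (c - W ε) ∂(fwdPathLaw ν₀ κF)) - 2 := by
  have hG := h.overlap_pos h0 c
  have hle := h.integral_sigmoid_le_accept h0 c
  rw [sub_le_sub_iff_right]
  exact one_div_le_one_div_of_le hG hle

/-! ## Both one-sided Jarzynski variances dominate the BAR variance constant -/

/-- **`1/G − 2 ≤ 1/ESS_F − 1`**: the BAR variance constant never exceeds the forward Jarzynski one,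
`E_F e^{−2W}/(E_F e^{−W})² − 1` (`bennett_lower_bound` at `nf = nr = 1` with `α ≡ 1`; `e^{−W} ∈ L²(P_F)`). -/
theorem inv_overlap_sub_two_le_inv_essF_sub_one [IsFiniteMeasure ν₀] [IsFiniteMeasure ν₁]
    [IsMarkovKernel κF] [IsMarkovKernel κR] (h0 : ν₀ univ ≠ 0) (h1 : ν₁ univ ≠ 0)
    (h : CrooksPair ν₀ ν₁ κF κR s e W) {ΔF : ℝ}
    (hΔF : Real.exp (-ΔF) = ((ν₀ univ)⁻¹ * ν₁ univ).toReal)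
    (hL2 : MemLp (fun ε => Real.exp (-W ε)) 2 (fwdPathLaw ν₀ κF)) :
    1 / (∫ ε, Real.sigmoid (ΔF - W ε) ∂(fwdPathLaw ν₀ κF)) - 2 ≤
      (∫ ε, Real.exp (-(2 * W ε)) ∂(fwdPathLaw ν₀ κF)) /
          (∫ ε, Real.exp (-W ε) ∂(fwdPathLaw ν₀ κF)) ^ 2 - 1 := by
  haveI := isProbabilityMeasure_fwdPathLaw ν₀ h0 κF
  haveI := isProbabilityMeasure_fwdPathLaw ν₁ h1 κR
  -- integrability of the density `e^{ΔF−W}` under `P_R` = square-integrability of `e^{−W}` under `P_F`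
  have hα2w : Integrable (fun ε => Real.exp (ΔF - W ε) * (fun _ : E => (1 : ℝ)) ε ^ 2)
      (fwdPathLaw ν₁ κR) := by
    have hsq : Integrable (fun ε => Real.exp (ΔF - W ε) * Real.exp (ΔF - W ε)) (fwdPathLaw ν₀ κF) := by
      refine (hL2.integrable_sq.const_mul (Real.exp ΔF * Real.exp ΔF)).congr
        (Eventually.of_forall fun ε => ?_)
      beta_reduce
      rw [sq, sub_eq_add_neg, Real.exp_add]
      ring
    have := (h.integrable_density_mul_iff h0 h1 hΔF (fun ε => Real.exp (ΔF - W ε))).1 hsq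
    refine this.congr (Eventually.of_forall fun ε => ?_)
    simp only [one_pow, mul_one]
  have hb := h.bennett_lower_bound h0 h1 hΔF one_pos one_pos (α := fun _ => (1 : ℝ)) measurable_const
    (by rw [integral_const, smul_eq_mul, mul_one, probReal_univ]; exact one_ne_zero)
    (by simp) hα2w
  rw [h.inv_overlap_sub_two_eq_bennett_bound h0 h1 hΔF]
  refine hb.trans (le_of_eq ?_)
  have hsqf : ∫ ε, ((1 : ℝ) * Real.exp (-W ε)) ^ 2 ∂(fwdPathLaw ν₀ κF) =
      ∫ ε, Real.exp (-(2 * W ε)) ∂(fwdPathLaw ν₀ κF) := by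
    refine integral_congr_ae (Eventually.of_forall fun ε => ?_)
    simp only
    rw [one_mul, sq, ← Real.exp_add]
    congr 1
    ring
  simp only [one_mul] at hsqf ⊢
  rw [hsqf, one_pow, integral_const, smul_eq_mul, mul_one, probReal_univ]
  ring

/-- **`1/G − 2 ≤ 1/ESS_R − 1`**: … nor the reverse Jarzynski one, `E_R e^{2W}/(E_R e^{W})² − 1`
(the pair read backwards; `e^{W} ∈ L²(P_R)`). -/
theorem inv_overlap_sub_two_le_inv_essR_sub_one [IsFiniteMeasure ν₀] [IsFiniteMeasure ν₁]
    [IsMarkovKernel κF] [IsMarkovKernel κR] (h0 : ν₀ univ ≠ 0) (h1 : ν₁ univ ≠ 0)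
    (h : CrooksPair ν₀ ν₁ κF κR s e W) {ΔF : ℝ}
    (hΔF : Real.exp (-ΔF) = ((ν₀ univ)⁻¹ * ν₁ univ).toReal)
    (hL2 : MemLp (fun ε => Real.exp (W ε)) 2 (fwdPathLaw ν₁ κR)) :
    1 / (∫ ε, Real.sigmoid (ΔF - W ε) ∂(fwdPathLaw ν₀ κF)) - 2 ≤
      (∫ ε, Real.exp (2 * W ε) ∂(fwdPathLaw ν₁ κR)) /
          (∫ ε, Real.exp (W ε) ∂(fwdPathLaw ν₁ κR)) ^ 2 - 1 := by
  have hΔF' : Real.exp (-(-ΔF)) = ((ν₁ univ)⁻¹ * ν₀ univ).toReal := exp_freeEnergyDiff h0 h1 hΔF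
  have hL2' : MemLp (fun ε => Real.exp (-(-W ε))) 2 (fwdPathLaw ν₁ κR) := by
    simpa only [neg_neg] using hL2
  have hs := h.symm.inv_overlap_sub_two_le_inv_essF_sub_one h1 h0 hΔF' hL2'
  simp only [neg_neg, mul_neg] at hs
  have hG : ∫ ε, Real.sigmoid (-ΔF - -W ε) ∂(fwdPathLaw ν₁ κR) =
      ∫ ε, Real.sigmoid (ΔF - W ε) ∂(fwdPathLaw ν₀ κF) := by
    rw [← h.integral_sigmoid_rev_eq_overlap h0 h1 hΔF]
    refine integral_congr_ae (Eventually.of_forall fun ε => ?_)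
    simp only
    congr 1
    ring
  rw [hG] at hs
  exact hs

end CrooksPair

end Summit.Ventures.LatticeQCDFlow.Exactness.GeneralNCMC
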